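/-
Copyright (c) 2026 the pub-hodgecm-mathlib formalisation cell (harness21).  Prover seat hodgecm-mathlib-LH4-p13 (g2), req620 Track A «(D-RAM) FOUR-FRAME» squad
(heir LEAD F0P3a-plan lineage; dealer LH4-plan lineage; MS ROAD A, Stage B re-keyed: the §P₂ ROTATIONS of the ★ type-2 glued socket — `stub_P_G2`₂, `stub_P_G3`₂ of the B10₂-MULT
assembly BY NAME).  2026-09-04.
-/
import Summits.HodgeConjecture.HodgeConjecture.Theorems.F0P3cDyRamDiagonalGluedSocketTwoStub   -- ★ p856576 FILE S (F0P3-p01 (g31)): `finsum_polarisationCount_mul_stabiliserWeight_stratumTwo_G1` (foot on `B₁`)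
import Summits.HodgeConjecture.HodgeConjecture.Theorems.F0P3cDyRamDiagonalPermutationTwo      -- ★ §P₂ p856311 + ED. 2 p856500 (this seat): `finsum_polarisationCount_mul_stabiliserWeight_stratumTwo_G2_of_G1 ∕ _G3_of_G1`
import HarnessLib

/-!
# Crux `H413`, MS ROAD A, STAGE B (re-keyed) — THE ROTATED TYPE-2 GLUED SOCKETS `stub_P_G2`₂, `stub_P_G3`₂ BY NAME

Cell `hodgecm-mathlib` (D-0151), FLOOR 0, crux item H413 = `stmt-HodgeConjecture-24833`, route of record `HCCMUnconditional`; squad F0∕P3c∕LH4 (req618∕req620).  THEOREMS ONLY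
(no `def`, no instance, no notation, no `sorry`, default heartbeats); lane `--supports stmt-HodgeConjecture-24833 --as helper` (count-neutral).  Road target: tree
`Cruxes/H413/Lines/F0_P3c_DyRamFourFrame_U3_Laws.lean` ED. 8 child (MS-B₂) `stub_U3_stableCount_typeTwo_mult`, paid by LH4-p10 (g2)'s B10₂-MULT assembly over ★ p856349
`finsum_mem_normalisedStableLattices_eq_of_typeTwo_table`, whose table binders `hG2 ∕ hG3` are — with the re-keyed weight `n₂·w` — exactly the two heads below.
F0P3-p01 (g31)'s ★ p856576 delivers the `B₁`-footed socket `Σᶠ_{stratumTwo(T, (2ρ+1, 2ρ+1+s, 2ρ+1+s))} n₂·w = ‹skeleton₂ :81 RHS›` at EVERY element datum; this seat's ★ §P₂ ED. 2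
adapters rotate it to the feet `B₂`, `B₃` (`(0 1)`-swap: datum `(β, α)`, depths `(n₂, n₁, n₃)`; `(0 2)`-swap + unit rescaling: datum `(α⁻¹, βα⁻¹)`, depths `(n₃, n₂, n₁)`; the wild
datum `(σ, ϖ, d, t)` and `N₀` are unchanged, so `hD`, `h2`, `hN₀` ride along).

WHAT IS PROVED (`K : Type`, `[Fintype 𝓀[K]]`, datum letters of ★ B1; `q = Fintype.card 𝓀[K]`; RHS = LH4-p10 (g2) skeleton₂ `B10-StableCountTypeTwo.SKELETON.v1` 08e5e6e2 binders
`hG2s ∕ hG3s` VERBATIM with the weight re-keyed per the 00:53Z ruling).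
* **`finsum_polarisationCount_mul_stabiliserWeight_stratumTwo_G2 (hD) (h2) (hE) (hN₀) (hT) (ρ s) (hs : 1 ≤ s)`** — axis `(2ρ+1+s, 2ρ+1, 2ρ+1+s)`: tube term iff
  `2∣s ∧ 2ρ+1 ≤ min n₁ n₃ ∧ 2ρ+1+s ≤ n₂`, glue term iff `2∣s ∧ n₁ = n₃ ∧ n₂ = n₁+s ∧ n₁ < 2ρ+1 ≤ 2n₁ ∧ 2ρ+1−n₁ ≤ n₁−d+1`.
* **`finsum_polarisationCount_mul_stabiliserWeight_stratumTwo_G3 (hD) (h2) (hE) (hN₀) (hT) (ρ s) (hs : 1 ≤ s)`** — axis `(2ρ+1+s, 2ρ+1+s, 2ρ+1)`: tube term iff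
  `2∣s ∧ 2ρ+1 ≤ min n₁ n₂ ∧ 2ρ+1+s ≤ n₃`, glue term iff `2∣s ∧ n₁ = n₂ ∧ n₃ = n₁+s ∧ n₁ < 2ρ+1 ≤ 2n₁ ∧ 2ρ+1−n₁ ≤ n₁−d+1`.
HONEST LABEL.  Count-neutral (`--supports`); nothing printed is asserted; (MS-B₂) and the census laws stay PROVER TARGETS until B10₂-MULT lands; `HC_CM` is proved only modulo the 7 printed
citations (2 remaining named inputs: hLiu418 = `stmt-HodgeConjecture-24832`, h413 = `stmt-HodgeConjecture-24833`) until rung 0 closes.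

## References
* [Kottwitz1986BaseChangeUnits] R. E. Kottwitz, *Base change for unit elements of Hecke algebras*, Compositio Math. 60 (1986), §1 pp. 240–241.
* [Rogawski1990] J. D. Rogawski, *Automorphic Representations of Unitary Groups in Three Variables*, Ann. of Math. Stud. 123 (1990), §4.9 Prop. 4.9.1 (a) p. 55.
-/

set_option autoImplicit false

noncomputable section

namespace Summit.HodgeConjecture.HodgeConjecture.Cruxes.H413.F0P3cDyRamDiagonalGluedSocketTwoRotations

open Matrix
open Literature.NumberTheory.Automorphic Literature.NumberTheory.Automorphic.HermitianLattice
open Literature.NumberTheory.Automorphic.UnitaryLatticeTree Literature.NumberTheory.Automorphic.UnitaryThreeFourFrame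
open Summit.HodgeConjecture.HodgeConjecture.Cruxes.H413.F0P3cDyRamDiagonalTorusDefs
open Summit.HodgeConjecture.HodgeConjecture.Cruxes.H413.F0P3cDyRamDiagonalStrataDefs
open Summit.HodgeConjecture.HodgeConjecture.Cruxes.H413.F0P3cDyRamDiagonalPermutationTwo
open Summit.HodgeConjecture.HodgeConjecture.Cruxes.H413.F0P3cDyRamDiagonalGluedSocketTwoStub (finsum_polarisationCount_mul_stabiliserWeight_stratumTwo_G1)
open scoped Valued WithZero Matrix MatrixGroups

variable {K : Type} [Field K] [Valued K ℤᵐ⁰] [Fintype 𝓀[K]] {σ : K →+* K} {ϖ : K} {d t : ℕ} {α β : K} {N₀ n₁ n₂ n₃ : ℕ} {T : GL (Fin 3) K}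

/-- **SOCKET `stub_P_G2`₂ (re-keyed) — THE TYPE-2 GLUED STRATUM WITH FOOT ON `B₂`, axis `(2ρ+1+s, 2ρ+1, 2ρ+1+s)`**: the `(0 1)`-rotation of F0P3-p01 (g31)'s ★ `B₁`-footed
socket by this seat's ★ §P₂ ED. 2 adapter (`polarisationCount` and `stabiliserWeight` are permutation-invariant); depths `(n₁, n₂) ↦ (n₂, n₁)` in the RHS.
[cite: Kottwitz1986BaseChangeUnits, §1 pp. 240–241] [cite: Rogawski1990, §4.9 Prop. 4.9.1 (a) p. 55] -/
theorem finsum_polarisationCount_mul_stabiliserWeight_stratumTwo_G2 (hD : IsRamifiedQuadraticDatum σ ϖ d t) (h2 : Valued.v (2 : K) < 1)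
    (hE : IsElementDatum σ ϖ N₀ α β n₁ n₂ n₃) (hN₀ : d ≤ N₀) (hT : (T : Matrix (Fin 3) (Fin 3) K) = Matrix.diagonal ![α, β, 1]) (ρ s : ℕ) (hs : 1 ≤ s) :
    ∑ᶠ M ∈ stratumTwo σ ϖ T ![2 * ρ + 1 + s, 2 * ρ + 1, 2 * ρ + 1 + s], (polarisationCount σ ϖ 2 M : ℚ) * stabiliserWeight σ M =
      (if 2 ∣ s ∧ 2 * ρ + 1 ≤ min n₁ n₃ ∧ 2 * ρ + 1 + s ≤ n₂ then (((Fintype.card 𝓀[K] : ℚ) - 1) * (Fintype.card 𝓀[K] : ℚ) ^ (2 * ρ + s / 2)) else 0) +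
      (if 2 ∣ s ∧ n₁ = n₃ ∧ n₂ = n₁ + s ∧ n₁ < 2 * ρ + 1 ∧ 2 * ρ + 1 ≤ 2 * n₁ ∧ 2 * ρ + 1 - n₁ ≤ n₁ - d + 1
        then ((Fintype.card 𝓀[K] : ℚ) ^ (2 * ρ + 1 + s / 2 - (2 * ρ + 1 - n₁ + 1) / 2)) else 0) :=
  finsum_polarisationCount_mul_stabiliserWeight_stratumTwo_G2_of_G1 hE hT (2 * ρ + 1) s
    (fun m₁ m₂ m₃ => (if 2 ∣ s ∧ 2 * ρ + 1 ≤ min m₂ m₃ ∧ 2 * ρ + 1 + s ≤ m₁ then (((Fintype.card 𝓀[K] : ℚ) - 1) * (Fintype.card 𝓀[K] : ℚ) ^ (2 * ρ + s / 2)) else 0) +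
      (if 2 ∣ s ∧ m₂ = m₃ ∧ m₁ = m₂ + s ∧ m₂ < 2 * ρ + 1 ∧ 2 * ρ + 1 ≤ 2 * m₂ ∧ 2 * ρ + 1 - m₂ ≤ m₂ - d + 1
        then ((Fintype.card 𝓀[K] : ℚ) ^ (2 * ρ + 1 + s / 2 - (2 * ρ + 1 - m₂ + 1) / 2)) else 0))
    fun _ hE' hT' => finsum_polarisationCount_mul_stabiliserWeight_stratumTwo_G1 hD h2 hE' hN₀ hT' ρ s hs

/-- **SOCKET `stub_P_G3`₂ (re-keyed) — THE TYPE-2 GLUED STRATUM WITH FOOT ON `B₃`, axis `(2ρ+1+s, 2ρ+1+s, 2ρ+1)`**: the `(0 2)`-rotation (with the unit rescaling by `α⁻¹`)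
of the ★ `B₁`-footed socket; depths `(n₁, n₂, n₃) ↦ (n₃, n₂, n₁)` in the RHS. [cite: Kottwitz1986BaseChangeUnits, §1 pp. 240–241] [cite: Rogawski1990, §4.9 Prop. 4.9.1 (a) p. 55] -/
theorem finsum_polarisationCount_mul_stabiliserWeight_stratumTwo_G3 (hD : IsRamifiedQuadraticDatum σ ϖ d t) (h2 : Valued.v (2 : K) < 1)
    (hE : IsElementDatum σ ϖ N₀ α β n₁ n₂ n₃) (hN₀ : d ≤ N₀) (hT : (T : Matrix (Fin 3) (Fin 3) K) = Matrix.diagonal ![α, β, 1]) (ρ s : ℕ) (hs : 1 ≤ s) :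
    ∑ᶠ M ∈ stratumTwo σ ϖ T ![2 * ρ + 1 + s, 2 * ρ + 1 + s, 2 * ρ + 1], (polarisationCount σ ϖ 2 M : ℚ) * stabiliserWeight σ M =
      (if 2 ∣ s ∧ 2 * ρ + 1 ≤ min n₁ n₂ ∧ 2 * ρ + 1 + s ≤ n₃ then (((Fintype.card 𝓀[K] : ℚ) - 1) * (Fintype.card 𝓀[K] : ℚ) ^ (2 * ρ + s / 2)) else 0) +
      (if 2 ∣ s ∧ n₁ = n₂ ∧ n₃ = n₁ + s ∧ n₁ < 2 * ρ + 1 ∧ 2 * ρ + 1 ≤ 2 * n₁ ∧ 2 * ρ + 1 - n₁ ≤ n₁ - d + 1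
        then ((Fintype.card 𝓀[K] : ℚ) ^ (2 * ρ + 1 + s / 2 - (2 * ρ + 1 - n₁ + 1) / 2)) else 0) := by
  have h := finsum_polarisationCount_mul_stabiliserWeight_stratumTwo_G3_of_G1 hD.2.1 hE hT (2 * ρ + 1) s
    (fun m₁ m₂ m₃ => (if 2 ∣ s ∧ 2 * ρ + 1 ≤ min m₂ m₃ ∧ 2 * ρ + 1 + s ≤ m₁ then (((Fintype.card 𝓀[K] : ℚ) - 1) * (Fintype.card 𝓀[K] : ℚ) ^ (2 * ρ + s / 2)) else 0) +
      (if 2 ∣ s ∧ m₂ = m₃ ∧ m₁ = m₂ + s ∧ m₂ < 2 * ρ + 1 ∧ 2 * ρ + 1 ≤ 2 * m₂ ∧ 2 * ρ + 1 - m₂ ≤ m₂ - d + 1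
        then ((Fintype.card 𝓀[K] : ℚ) ^ (2 * ρ + 1 + s / 2 - (2 * ρ + 1 - m₂ + 1) / 2)) else 0))
    fun _ hE' hT' => finsum_polarisationCount_mul_stabiliserWeight_stratumTwo_G1 hD h2 hE' hN₀ hT' ρ s hs
  rw [h, min_comm n₂ n₁]
  congr 1
  by_cases hc : 2 ∣ s ∧ n₁ = n₂ ∧ n₃ = n₁ + s ∧ n₁ < 2 * ρ + 1 ∧ 2 * ρ + 1 ≤ 2 * n₁ ∧ 2 * ρ + 1 - n₁ ≤ n₁ - d + 1
  · obtain ⟨h2s, h12, h3, hlt, hle, hgl⟩ := hc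
    rw [if_pos ⟨h2s, h12.symm, h12 ▸ h3, h12 ▸ hlt, h12 ▸ hle, h12 ▸ hgl⟩, if_pos ⟨h2s, h12, h3, hlt, hle, hgl⟩, ← h12]
  · rw [if_neg hc, if_neg]
    rintro ⟨h2s, h21, h3, hlt, hle, hgl⟩
    exact hc ⟨h2s, h21.symm, h21.symm ▸ h3, h21.symm ▸ hlt, h21.symm ▸ hle, h21.symm ▸ hgl⟩

end Summit.HodgeConjecture.HodgeConjecture.Cruxes.H413.F0P3cDyRamDiagonalGluedSocketTwoRotations

end
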